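import Summits.HubbardSuperconductivity.HubbardSuperconductivity.Theorems.AnisotropyChordInsertionEntropyLogDirichlet
import Summits.HubbardSuperconductivity.HubbardSuperconductivity.Theorems.AnisotropyChordInsertionEntropyJDiv
import Summits.HubbardSuperconductivity.HubbardSuperconductivity.Theorems.AnisotropyChordInsertionEntropyResidue
import Mathlib.Analysis.Convex.Jensen
import Mathlib.Analysis.SpecialFunctions.Log.Basic
import Mathlib.Analysis.Convex.SpecificFunctions.Basic

/-!
# Route `AnisotropyChord` / H0 rotor rung: TWO-SIDED LOG-DIRICHLET, RÉNYI-½ ≤ J/2, and the sharpened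
# E-FLOOR-J (exponent `−J/2`) (theory seat `hubbard-h0-rotor-theory-1`, cycle 9, memo ROTOR-THEORY-9 §127;
# Sketch9 Parts A–B ported, work-order W12, plus the J-floor corollaries)

Part A.  LOG-DIRICHLET, ν-SIDE.  For `r` reversible w.r.t. `m` and a positive solution of `μΦ = Σ r (Φ − Φ′) + WΦ`:
* `dirichlet_identity_nu` : `½ ΣΣ m r (Φ − Φ′)² = Σ m (μ − W) Φ²` (variational energy identity);
* `mul_log_sub_log_sq_le` : `a b (log b − log a)² ≤ (a − b)²` (`a, b > 0`);
* `logDirichlet_nu_energy_le` : `½ ΣΣ m r Φ Φ′ (log Φ′ − log Φ)² ≤ Σ m (μ − W) Φ²` — the log-Dirichlet energy of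
  `log Φ` under the TILTED law `ν ∝ m Φ²` is at most `μ − E_ν W` per unit ν-mass (the tree's `logDirichlet_energy_le`
  is the `m`-side `≤ E_m W − μ`);
* `chemicalPotential_sandwich` : `E_ν W ≤ μ ≤ E_m W` (sum form).

Part B.  RÉNYI-½ ≤ MEAN-LOG-SHIFT (= J/2).  For a probability vector `m` and `Φ > 0`,
`log E_m Φ² − 2 log E_m Φ ≤ E_ν log Φ − E_m log Φ` with `ν = m Φ²/E_m Φ²` (two Jensen inequalities for `log`):
`sum_mul_log_le_log_sum`, `renyiHalf_le_meanLogShift`, `residue_ge_exp_neg_meanLogShift`.  The EXACT currency of the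
condensation half is the Rényi-½ divergence `D_½(ν ‖ m) = −log BC²` (memo §127).

Part B′ (corollaries in the tree's lattice currency).  `bhatt_sq_ge_exp_neg_half_jDiv` : `BC(p,q)² ≥ e^{−J(p,q)/2}` for
mutually absolutely continuous laws (the tree's LEMMA J gives `e^{−KL}`, and `KL ≤ J` gave E-FLOOR-J with `e^{−J}`);
`bhatt_bornLaw_eq_sqrt_mul_bhatt_vacantLaw` : `BC(ν_x, π) = √(1 − ρ_M(x)) · BC(ν_x, π̃_x)`;
**`condensateDensity_ge_of_jDiv_half`** : `n₀/|V| ≥ ρ (1 − ρ_M) · e^{−K/2}` from `sup_x J(ν_x, π̃_x) ≤ K` — THEOREM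
E-FLOOR-J of `…InsertionEntropyJDiv` with the exponent halved.
-/

set_option linter.dupNamespace false

noncomputable section

open Finset

namespace Summit.HubbardSuperconductivity.HubbardSuperconductivity.Theorems.AnisotropyChord.InsertionEntropy

section LogDirichletNu

variable {Ω : Type*} [Fintype Ω]

/-- **Variational energy identity (ν-side of LOG-DIRICHLET).**  For `r` reversible w.r.t. `m` and a solution of
`μΦ = Σ_ω′ r(ω,ω′)(Φ(ω) − Φ(ω′)) + W Φ`:  `½ Σ_ω Σ_ω′ m r (Φ(ω) − Φ(ω′))² = Σ_ω m (μ − W) Φ²`.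
Theory seat memo ROTOR-THEORY-9 §127. [folklore] -/
theorem dirichlet_identity_nu (m : Ω → ℝ) (r : Ω → Ω → ℝ) (Φ W : Ω → ℝ) (μ : ℝ)
    (hrev : ∀ ω ω', m ω * r ω ω' = m ω' * r ω' ω)
    (heq : ∀ ω, μ * Φ ω = (∑ ω', r ω ω' * (Φ ω - Φ ω')) + W ω * Φ ω) :
    (1 / 2 : ℝ) * ∑ ω, ∑ ω', m ω * r ω ω' * (Φ ω - Φ ω') ^ 2
      = ∑ ω, m ω * (μ - W ω) * Φ ω ^ 2 := by
  -- T1 := ΣΣ m r Φ (Φ − Φ′) evaluates through the equation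
  have hT1 : ∑ ω, ∑ ω', m ω * r ω ω' * (Φ ω * (Φ ω - Φ ω')) = ∑ ω, m ω * (μ - W ω) * Φ ω ^ 2 := by
    refine Finset.sum_congr rfl fun ω _ => ?_
    have h1 : ∑ ω', m ω * r ω ω' * (Φ ω * (Φ ω - Φ ω'))
        = m ω * Φ ω * ∑ ω', r ω ω' * (Φ ω - Φ ω') := by
      rw [Finset.mul_sum]; refine Finset.sum_congr rfl fun ω' _ => ?_; ring
    have h2 : ∑ ω', r ω ω' * (Φ ω - Φ ω') = (μ - W ω) * Φ ω := by have := heq ω; linarith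
    rw [h1, h2]; ring
  -- T2 := ΣΣ m r Φ′ (Φ − Φ′) = −T1 by reversibility
  have hT2 : ∑ ω, ∑ ω', m ω * r ω ω' * (Φ ω' * (Φ ω - Φ ω'))
      = -∑ ω, ∑ ω', m ω * r ω ω' * (Φ ω * (Φ ω - Φ ω')) := by
    rw [Finset.sum_comm, ← Finset.sum_neg_distrib]
    refine Finset.sum_congr rfl fun ω _ => ?_
    rw [← Finset.sum_neg_distrib]
    refine Finset.sum_congr rfl fun ω' _ => ?_
    rw [hrev ω' ω]; ring
  have hsplit : ∑ ω, ∑ ω', m ω * r ω ω' * (Φ ω - Φ ω') ^ 2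
      = ∑ ω, ∑ ω', m ω * r ω ω' * (Φ ω * (Φ ω - Φ ω'))
        - ∑ ω, ∑ ω', m ω * r ω ω' * (Φ ω' * (Φ ω - Φ ω')) := by
    rw [← Finset.sum_sub_distrib]; refine Finset.sum_congr rfl fun ω _ => ?_
    rw [← Finset.sum_sub_distrib]; refine Finset.sum_congr rfl fun ω' _ => ?_; ring
  rw [hsplit, hT2, hT1]; ring

/-- `a b (log b − log a)² ≤ (a − b)²` for `a, b > 0` (from `(log t)² ≤ t + 1/t − 2`, the tree's `log_sq_le_ratio`). [folklore] -/
theorem mul_log_sub_log_sq_le (a b : ℝ) (ha : 0 < a) (hb : 0 < b) :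
    a * b * (Real.log b - Real.log a) ^ 2 ≤ (a - b) ^ 2 := by
  have h := log_sq_le_ratio (b / a) (div_pos hb ha)
  rw [Real.log_div hb.ne' ha.ne'] at h
  have hab : 0 < a * b := mul_pos ha hb
  have key : a * b * (b / a + 1 / (b / a) - 2) = (a - b) ^ 2 := by
    field_simp
    ring
  calc a * b * (Real.log b - Real.log a) ^ 2
      ≤ a * b * (b / a + 1 / (b / a) - 2) := mul_le_mul_of_nonneg_left h hab.le
    _ = (a - b) ^ 2 := key

/-- **LEMMA LOG-DIRICHLET, ν-side energy form.**  For `r ≥ 0` reversible w.r.t. `m ≥ 0` and a positive solution of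
`μΦ = Σ r (Φ − Φ′) + WΦ`, the `Φ Φ′`-weighted (i.e. `ν ∝ mΦ²`-side) log-Dirichlet energy is at most `Σ m (μ − W) Φ²`:
`½ Σ_ω Σ_ω′ m r Φ(ω) Φ(ω′) (log Φ(ω′) − log Φ(ω))² ≤ Σ_ω m (μ − W) Φ²`.  Per unit `ν`-mass: `ℰ_ν(log Φ) ≤ μ − E_ν W`;
the tree's `logDirichlet_energy_le` is the `m`-side `ℰ_m(log Φ) ≤ E_m W − μ`. Theory seat memo ROTOR-THEORY-9 §127. [folklore] -/
theorem logDirichlet_nu_energy_le (m : Ω → ℝ) (r : Ω → Ω → ℝ) (Φ W : Ω → ℝ) (μ : ℝ)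
    (hm : ∀ ω, 0 ≤ m ω) (hr : ∀ ω ω', 0 ≤ r ω ω')
    (hrev : ∀ ω ω', m ω * r ω ω' = m ω' * r ω' ω) (hΦ : ∀ ω, 0 < Φ ω)
    (heq : ∀ ω, μ * Φ ω = (∑ ω', r ω ω' * (Φ ω - Φ ω')) + W ω * Φ ω) :
    (1 / 2 : ℝ) * ∑ ω, ∑ ω', m ω * r ω ω' * (Φ ω * Φ ω' * (Real.log (Φ ω') - Real.log (Φ ω)) ^ 2)
      ≤ ∑ ω, m ω * (μ - W ω) * Φ ω ^ 2 := by
  rw [← dirichlet_identity_nu m r Φ W μ hrev heq]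
  refine mul_le_mul_of_nonneg_left ?_ (by norm_num)
  refine Finset.sum_le_sum fun ω _ => Finset.sum_le_sum fun ω' _ => ?_
  refine mul_le_mul_of_nonneg_left ?_ (mul_nonneg (hm ω) (hr ω ω'))
  exact mul_log_sub_log_sq_le (Φ ω) (Φ ω') (hΦ ω) (hΦ ω')

/-- **Chemical-potential sandwich** `E_ν W ≤ μ ≤ E_m W` (sum form): both log-Dirichlet energies are non-negative.
Theory seat memo ROTOR-THEORY-9 §127. [folklore] -/
theorem chemicalPotential_sandwich (m : Ω → ℝ) (r : Ω → Ω → ℝ) (Φ W : Ω → ℝ) (μ : ℝ)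
    (hm : ∀ ω, 0 ≤ m ω) (hr : ∀ ω ω', 0 ≤ r ω ω')
    (hrev : ∀ ω ω', m ω * r ω ω' = m ω' * r ω' ω) (hΦ : ∀ ω, 0 < Φ ω)
    (heq : ∀ ω, μ * Φ ω = (∑ ω', r ω ω' * (Φ ω - Φ ω')) + W ω * Φ ω) :
    (∑ ω, m ω * W ω * Φ ω ^ 2 ≤ μ * ∑ ω, m ω * Φ ω ^ 2) ∧ (μ * ∑ ω, m ω ≤ ∑ ω, m ω * W ω) := by
  constructor
  · -- ν-side: 0 ≤ ½ ΣΣ m r (Φ − Φ′)² = Σ m (μ − W) Φ²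
    have h0 : 0 ≤ (1 / 2 : ℝ) * ∑ ω, ∑ ω', m ω * r ω ω' * (Φ ω - Φ ω') ^ 2 := by
      refine mul_nonneg (by norm_num) (Finset.sum_nonneg fun ω _ => Finset.sum_nonneg fun ω' _ => ?_)
      exact mul_nonneg (mul_nonneg (hm ω) (hr ω ω')) (sq_nonneg _)
    rw [dirichlet_identity_nu m r Φ W μ hrev heq] at h0
    have : ∑ ω, m ω * (μ - W ω) * Φ ω ^ 2 = μ * ∑ ω, m ω * Φ ω ^ 2 - ∑ ω, m ω * W ω * Φ ω ^ 2 := by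
      rw [Finset.mul_sum, ← Finset.sum_sub_distrib]
      refine Finset.sum_congr rfl fun ω _ => ?_; ring
    linarith
  · -- m-side: 0 ≤ ½ ΣΣ m r (log Φ′ − log Φ)² ≤ Σ m (W − μ)
    have h0 : 0 ≤ (1 / 2 : ℝ) * ∑ ω, ∑ ω', m ω * r ω ω' * (Real.log (Φ ω') - Real.log (Φ ω)) ^ 2 := by
      refine mul_nonneg (by norm_num) (Finset.sum_nonneg fun ω _ => Finset.sum_nonneg fun ω' _ => ?_)
      exact mul_nonneg (mul_nonneg (hm ω) (hr ω ω')) (sq_nonneg _)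
    have h1 := logDirichlet_energy_le m r Φ W μ hm hr hrev hΦ heq
    have : ∑ ω, m ω * (W ω - μ) = ∑ ω, m ω * W ω - μ * ∑ ω, m ω := by
      rw [Finset.mul_sum, ← Finset.sum_sub_distrib]
      refine Finset.sum_congr rfl fun ω _ => ?_; ring
    linarith

end LogDirichletNu

section RenyiHalf

variable {Ω : Type*} [Fintype Ω]

/-- Jensen for `log` on a finite type: `Σ w log z ≤ log Σ w z` for a probability vector `w` and `z > 0`. [folklore] -/
theorem sum_mul_log_le_log_sum (w z : Ω → ℝ) (hw : ∀ ω, 0 ≤ w ω) (hw1 : ∑ ω, w ω = 1)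
    (hz : ∀ ω, 0 < z ω) :
    ∑ ω, w ω * Real.log (z ω) ≤ Real.log (∑ ω, w ω * z ω) := by
  have hconc : ConcaveOn ℝ (Set.Ioi (0 : ℝ)) Real.log := strictConcaveOn_log_Ioi.concaveOn
  have h := hconc.le_map_sum (t := Finset.univ) (w := w) (p := z)
    (fun ω _ => hw ω) hw1 (fun ω _ => Set.mem_Ioi.mpr (hz ω))
  simpa [smul_eq_mul] using h

/-- **RÉNYI-½ ≤ MEAN-LOG-SHIFT.**  For a probability vector `m` and `Φ > 0`, with `S₁ = E_m Φ`, `S₂ = E_m Φ²` and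
`ν = m Φ²/S₂`:  `log S₂ − 2 log S₁ ≤ (Σ m Φ² log Φ)/S₂ − Σ m log Φ`, i.e.
`D_½(ν ‖ m) = −log (S₁²/S₂) ≤ E_ν log Φ − E_m log Φ = J(ν, m)/2`.  Two Jensen inequalities: `E_m log Φ ≤ log E_m Φ`
and `E_ν log (1/Φ) ≤ log E_ν (1/Φ) = log (S₁/S₂)`. Theory seat memo ROTOR-THEORY-9 §127. [folklore] -/
theorem renyiHalf_le_meanLogShift (m Φ : Ω → ℝ) (hm : ∀ ω, 0 ≤ m ω) (hm1 : ∑ ω, m ω = 1)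
    (hΦ : ∀ ω, 0 < Φ ω) :
    Real.log (∑ ω, m ω * Φ ω ^ 2) - 2 * Real.log (∑ ω, m ω * Φ ω)
      ≤ (∑ ω, m ω * Φ ω ^ 2 * Real.log (Φ ω)) / (∑ ω, m ω * Φ ω ^ 2) - ∑ ω, m ω * Real.log (Φ ω) := by
  -- some weight is positive
  obtain ⟨ω₀, hω₀⟩ : ∃ ω, 0 < m ω := by
    by_contra h
    push Not at h
    have : ∑ ω, m ω = 0 := Finset.sum_eq_zero fun ω _ => le_antisymm (h ω) (hm ω)
    rw [hm1] at this; exact one_ne_zero this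
  set S₁ := ∑ ω, m ω * Φ ω with hS₁
  set S₂ := ∑ ω, m ω * Φ ω ^ 2 with hS₂
  have hS₁pos : 0 < S₁ := by
    rw [hS₁]
    refine Finset.sum_pos' (fun ω _ => mul_nonneg (hm ω) (hΦ ω).le) ⟨ω₀, Finset.mem_univ _, mul_pos hω₀ (hΦ ω₀)⟩
  have hS₂pos : 0 < S₂ := by
    rw [hS₂]
    refine Finset.sum_pos' (fun ω _ => mul_nonneg (hm ω) (pow_nonneg (hΦ ω).le _))
      ⟨ω₀, Finset.mem_univ _, mul_pos hω₀ (pow_pos (hΦ ω₀) _)⟩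
  -- Jensen 1 under m
  have J1 : ∑ ω, m ω * Real.log (Φ ω) ≤ Real.log S₁ := sum_mul_log_le_log_sum m Φ hm hm1 hΦ
  -- Jensen 2 under ν = mΦ²/S₂ with z = 1/Φ
  set ν : Ω → ℝ := fun ω => m ω * Φ ω ^ 2 / S₂ with hν
  have hν0 : ∀ ω, 0 ≤ ν ω := fun ω => div_nonneg (mul_nonneg (hm ω) (pow_nonneg (hΦ ω).le _)) hS₂pos.le
  have hν1 : ∑ ω, ν ω = 1 := by
    simp only [hν]
    rw [← Finset.sum_div, div_self hS₂pos.ne']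
  have J2 := sum_mul_log_le_log_sum ν (fun ω => 1 / Φ ω) hν0 hν1 (fun ω => by
    have := hΦ ω; positivity)
  have hEν : ∑ ω, ν ω * (1 / Φ ω) = S₁ / S₂ := by
    simp only [hν]
    rw [hS₁, Finset.sum_div]
    refine Finset.sum_congr rfl fun ω _ => ?_
    have := (hΦ ω).ne'
    field_simp
  rw [hEν, Real.log_div hS₁pos.ne' hS₂pos.ne'] at J2
  have hlog_inv : ∀ ω, Real.log (1 / Φ ω) = -Real.log (Φ ω) := fun ω => by
    rw [one_div, Real.log_inv]
  simp only [hlog_inv, mul_neg, Finset.sum_neg_distrib] at J2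
  -- Σ ν log Φ = (Σ m Φ² log Φ)/S₂
  have hνlog : ∑ ω, ν ω * Real.log (Φ ω) = (∑ ω, m ω * Φ ω ^ 2 * Real.log (Φ ω)) / S₂ := by
    simp only [hν]
    rw [Finset.sum_div]
    refine Finset.sum_congr rfl fun ω _ => ?_
    ring
  rw [← hνlog]
  linarith

/-- **Corollary (sharp exponent in E-FLOOR-J).**  In the same setting, `S₁²/S₂ ≥ exp(−(E_ν log Φ − E_m log Φ))`:
the Bhattacharyya residue `R = (E_m Φ)²/E_m Φ²` is at least `e^{−J/2}` (the tree's E-FLOOR-J uses `e^{−J}`).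
Theory seat memo ROTOR-THEORY-9 §127. [folklore] -/
theorem residue_ge_exp_neg_meanLogShift (m Φ : Ω → ℝ) (hm : ∀ ω, 0 ≤ m ω) (hm1 : ∑ ω, m ω = 1)
    (hΦ : ∀ ω, 0 < Φ ω) :
    Real.exp (-((∑ ω, m ω * Φ ω ^ 2 * Real.log (Φ ω)) / (∑ ω, m ω * Φ ω ^ 2) - ∑ ω, m ω * Real.log (Φ ω)))
      ≤ (∑ ω, m ω * Φ ω) ^ 2 / (∑ ω, m ω * Φ ω ^ 2) := by
  obtain ⟨ω₀, hω₀⟩ : ∃ ω, 0 < m ω := by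
    by_contra h
    push Not at h
    have : ∑ ω, m ω = 0 := Finset.sum_eq_zero fun ω _ => le_antisymm (h ω) (hm ω)
    rw [hm1] at this; exact one_ne_zero this
  have hS₁pos : 0 < ∑ ω, m ω * Φ ω :=
    Finset.sum_pos' (fun ω _ => mul_nonneg (hm ω) (hΦ ω).le) ⟨ω₀, Finset.mem_univ _, mul_pos hω₀ (hΦ ω₀)⟩
  have hS₂pos : 0 < ∑ ω, m ω * Φ ω ^ 2 :=
    Finset.sum_pos' (fun ω _ => mul_nonneg (hm ω) (pow_nonneg (hΦ ω).le _))
      ⟨ω₀, Finset.mem_univ _, mul_pos hω₀ (pow_pos (hΦ ω₀) _)⟩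
  have h := renyiHalf_le_meanLogShift m Φ hm hm1 hΦ
  have hR : 0 < (∑ ω, m ω * Φ ω) ^ 2 / ∑ ω, m ω * Φ ω ^ 2 := div_pos (pow_pos hS₁pos 2) hS₂pos
  rw [← Real.exp_log hR, Real.exp_le_exp, Real.log_div (pow_pos hS₁pos 2).ne' hS₂pos.ne', Real.log_pow]
  push_cast
  linarith

/-- **`BC(p,q)² ≥ e^{−J(p,q)/2}`** for mutually absolutely continuous probability laws (Part B with `m = q`,
`Φ = √(p/q)`: then `E_q Φ = BC(p,q)`, `E_q Φ² = 1`, and the mean log shift is `J(p,q)/2`).  Sharpens the tree's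
LEMMA J + `KL ≤ J` (`BC ≥ e^{−KL/2} ≥ e^{−J/2}`) by a factor 2 in the exponent. Theory seat memo ROTOR-THEORY-9 §127. [folklore] -/
theorem bhatt_sq_ge_exp_neg_half_jDiv (p q : Ω → ℝ) (hp : ∀ ω, 0 ≤ p ω) (hq : ∀ ω, 0 ≤ q ω)
    (hp1 : ∑ ω, p ω = 1) (hq1 : ∑ ω, q ω = 1) (hac : ∀ ω, 0 < p ω ↔ 0 < q ω) :
    Real.exp (-(jDiv p q) / 2) ≤ bhatt p q ^ 2 := by
  classical
  -- Φ = √(p/q) on the common support, 1 off it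
  set Φ : Ω → ℝ := fun ω => if 0 < q ω then Real.sqrt (p ω / q ω) else 1 with hΦdef
  have hpq : ∀ ω, 0 < q ω → 0 < p ω := fun ω h => (hac ω).mpr h
  have hq0 : ∀ ω, ¬ 0 < q ω → q ω = 0 := fun ω h => le_antisymm (not_lt.mp h) (hq ω)
  have hp0 : ∀ ω, ¬ 0 < q ω → p ω = 0 := by
    intro ω h
    by_contra hne
    exact h ((hac ω).mp (lt_of_le_of_ne (hp ω) (Ne.symm hne)))
  have hΦpos : ∀ ω, 0 < Φ ω := by
    intro ω
    simp only [hΦdef]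
    split_ifs with h
    · exact Real.sqrt_pos.mpr (div_pos (hpq ω h) h)
    · exact one_pos
  have hΦsq : ∀ ω, 0 < q ω → Φ ω ^ 2 = p ω / q ω := by
    intro ω h
    simp only [hΦdef, if_pos h]
    exact Real.sq_sqrt (div_nonneg (hp ω) (hq ω))
  -- E_q Φ = BC
  have hS₁ : ∑ ω, q ω * Φ ω = bhatt p q := by
    unfold bhatt
    refine Finset.sum_congr rfl fun ω _ => ?_
    by_cases h : 0 < q ω
    · simp only [hΦdef, if_pos h]
      rw [← Real.sqrt_sq (hq ω), ← Real.sqrt_mul (sq_nonneg _), Real.sqrt_sq (hq ω)]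
      congr 1
      field_simp
    · rw [hq0 ω h, hp0 ω h]; simp
  -- E_q Φ² = 1
  have hS₂ : ∑ ω, q ω * Φ ω ^ 2 = 1 := by
    rw [← hp1]
    refine Finset.sum_congr rfl fun ω _ => ?_
    by_cases h : 0 < q ω
    · rw [hΦsq ω h]; field_simp
    · rw [hq0 ω h, hp0 ω h]; simp
  -- Σ q Φ² log Φ = Σ p log Φ and the shift is J/2
  have hnum : ∑ ω, q ω * Φ ω ^ 2 * Real.log (Φ ω) = ∑ ω, p ω * Real.log (Φ ω) := by
    refine Finset.sum_congr rfl fun ω _ => ?_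
    by_cases h : 0 < q ω
    · rw [hΦsq ω h]; field_simp
    · rw [hq0 ω h, hp0 ω h]; simp
  have hshift : ∑ ω, p ω * Real.log (Φ ω) - ∑ ω, q ω * Real.log (Φ ω) = jDiv p q / 2 := by
    unfold jDiv
    rw [← Finset.sum_sub_distrib, Finset.sum_div]
    refine Finset.sum_congr rfl fun ω _ => ?_
    by_cases h : 0 < q ω
    · have hp' := hpq ω h
      simp only [hΦdef, if_pos h]
      rw [Real.log_sqrt (div_nonneg (hp ω) (hq ω))]
      ring
    · rw [hq0 ω h, hp0 ω h]; simp
  have main := residue_ge_exp_neg_meanLogShift q Φ hq hq1 hΦpos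
  rw [hS₂, div_one, hnum, hshift, hS₁, div_one] at main
  have e : -(jDiv p q) / 2 = -(jDiv p q / 2) := by ring
  rw [e]
  exact main

end RenyiHalf

section LatticeJHalf

variable {V : Type} [Fintype V] [DecidableEq V]

/-- `BC(ν_x, π) = √(1 − ρ_M(x)) · BC(ν_x, π̃_x)`: the Born law and the vacancy-conditioned law differ by the constant
factor `1 − ρ_M(x)` on the support `{x empty}` of the hole law. [folklore] -/
theorem bhatt_bornLaw_eq_sqrt_mul_bhatt_vacantLaw (aM aN : (V → Fin 2) → ℝ) (x : V)
    (hq : siteDensity aM x < 1) :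
    bhatt (holeLaw aN x) (bornLaw aM)
      = Real.sqrt (1 - siteDensity aM x) * bhatt (holeLaw aN x) (vacantLaw aM x) := by
  have hqpos : 0 < 1 - siteDensity aM x := sub_pos.mpr hq
  unfold bhatt holeLaw bornLaw vacantLaw
  rw [Finset.mul_sum]
  refine Finset.sum_congr rfl fun τ _ => ?_
  by_cases hτ : τ x = 1
  · rw [if_pos hτ, if_pos hτ, ← Real.sqrt_mul hqpos.le]
    congr 1
    field_simp
  · rw [if_neg hτ, if_neg hτ]
    simp

/-- **THEOREM E-FLOOR-J, sharp exponent.**  `n₀/|V| ≥ ρ (1 − ρ_M) · exp(−sup_x J(ν_x, π̃_x)/2)` — the tree's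
`condensateDensity_ge_of_jDiv` with the exponent halved (via `bhatt_sq_ge_exp_neg_half_jDiv` and the residue floor
`condensateDensity_ge_of_residue`; `Z_x = BC(ν_x, π̃_x)²`). Theory seat memo ROTOR-THEORY-9 §127. [folklore] -/
theorem condensateDensity_ge_of_jDiv_half [Nonempty V] (aM aN : (V → Fin 2) → ℝ) (ρ ρM K : ℝ)
    (hρ : 0 < ρ) (hρM : ρM < 1) (hM : ∀ τ, 0 ≤ aM τ) (hN : ∀ σ, 0 ≤ aN σ) (hM1 : ∑ τ, aM τ ^ 2 = 1)
    (hdens : ∀ x, siteDensity aN x = ρ) (hdensM : ∀ x, siteDensity aM x = ρM)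
    (hac : ∀ x τ, 0 < holeLaw aN x τ ↔ 0 < vacantLaw aM x τ)
    (hK : ∀ x, jDiv (holeLaw aN x) (vacantLaw aM x) ≤ K) :
    ρ * (1 - ρM) * Real.exp (-K / 2) ≤ condensateDensity aN := by
  have hρx : ∀ x, 0 < siteDensity aN x := fun x => by rw [hdens x]; exact hρ
  have hqx : ∀ x, siteDensity aM x < 1 := fun x => by rw [hdensM x]; exact hρM
  refine condensateDensity_ge_of_residue aM aN ρ ρM (Real.exp (-K / 2)) hρ hρM (Real.exp_pos _).le hM hN hM1
    hdens hdensM fun x => ?_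
  -- Z_x = BC(ν_x, π̃_x)² ≥ e^{−J_x/2} ≥ e^{−K/2}
  have hq1 : 0 < 1 - siteDensity aM x := sub_pos.mpr (hqx x)
  have hres : insertionResidue aM aN x = bhatt (holeLaw aN x) (vacantLaw aM x) ^ 2 := by
    have h := bhatt_sq_eq_residue aM aN x hM hN (hρx x) (hqx x)
    rw [bhatt_bornLaw_eq_sqrt_mul_bhatt_vacantLaw aM aN x (hqx x), mul_pow, Real.sq_sqrt hq1.le] at h
    exact (mul_left_cancel₀ hq1.ne' h).symm
  rw [hres]
  have hJ := bhatt_sq_ge_exp_neg_half_jDiv (holeLaw aN x) (vacantLaw aM x) (holeLaw_nonneg aN x (hρx x))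
    (vacantLaw_nonneg aM x (hqx x)) (sum_holeLaw aN x (hρx x)) (sum_vacantLaw aM x hM1 (hqx x)) (hac x)
  refine le_trans (Real.exp_le_exp.mpr ?_) hJ
  have := hK x
  linarith

end LatticeJHalf

end Summit.HubbardSuperconductivity.HubbardSuperconductivity.Theorems.AnisotropyChord.InsertionEntropy
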